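import Literature.AlgebraicGeometry.HodgeTheory.DualLefschetzInLefschetzInvolutionAlgebra
import Literature.AlgebraicGeometry.Hyperkaehler.TotalCohomologyLefschetzModule
import Literature.Algebra.Lie.LefschetzModuleStringReversal
import Literature.AlgebraicGeometry.Hyperkaehler.LLVStructureKummerType
import Literature.AlgebraicGeometry.HodgeTheory.TopDegreeClasses
import Literature.AlgebraicTopology.SingularHomology.CohomologyOfPoint
import HarnessLib

/-!
# André 1996 §1.1–1.2 / Prop. 1.2 (Kleiman 1968, 1.4.4–1.4.6) PROVED: the `sl(2)`-partner `ᶜΛ` of a hard-Lefschetz class exists and lies in `ℂ[L, *_L]`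

Layer `Literature/AlgebraicGeometry/HodgeTheory`.  DISCHARGE (D-0014: `theorem X_holds : X`) of the named fact
`Andre1996_dualLefschetz_mem_adjoin_lefschetzInvolution` of `DualLefschetzInLefschetzInvolutionAlgebra.lean` (cell
`hodge-kum4`, ladder HodgeAV rung H3; the fact is the binder `hAn` of the by-name closer
`Summit.Ventures.HodgeKum4.hc_kum4Type_of_L1_of_split125`, p451323).  Net debt `-1`; no definition, no new fact,
no `sorry`.  Nothing here concerns the Hodge conjecture.

## The statement discharged (verbatim from the definition file)

For `d ≥ 1`, `X` smooth projective of dimension `d` over `ℂ`, `η ∈ H²(X(ℂ); ℂ)` with the hard Lefschetz property in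
dimension `d` (`Geometry.Kaehler.HasHardLefschetzProperty η d`): there is `Λ ∈ End_ℂ H*(X(ℂ); ℂ)` with
`Hyperkaehler.IsDualLefschetz d η Λ` (Mathlib `IsSl2Triple h L_η Λ`, `h` the degree operator) and
`Λ ∈ Algebra.adjoin ℂ {L_η, *_L}` (`*_L = totalLefschetzInvolution hL`).  Source: Y. André, *Pour une théorie
inconditionnelle des motifs*, Publ. Math. IHÉS 83 (1996), §1.1–1.2 and Prop. 1.2 (p. 11): "`(ᶜΛ, h, L)` forme un
`sl₂`-triplet"; "Les sous-algèbres `ℚ[L, *_L]`, `ℚ[L, *_H]`, `ℚ[L, *_L L *_L]`, `ℚ[L, ᶜΛ]` de `End H*(X)` sont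
égales […] *Preuve.* — Pour la première assertion, on renvoie à [Kl68] 1.4.4, 1.4.5."

## Proof (kernel; the printed one)

1. `H*(X(ℂ); ℂ) = ⨁ₖ Hᵏ` with `h = degreeOperator d` and `e = L_η` is a finite-dimensional `ℤ`-graded Lefschetz
   module (`Hyperkaehler/TotalCohomologyLefschetzModule`: `hasLefschetzProperty_totalLefschetz` from
   `HasHardLefschetzProperty η d` and `Hᵏ(X(ℂ); ℂ) = 0` for `k > 2d` — the tree's PROVED
   `Motives.ComplexPoints.subsingleton_singularCohomology_of_lt`; finite dimension: the tree's PROVED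
   `Hyperkaehler.finite_totalCohomology`; `h ≠ 0`: `H⁰(X(ℂ); ℂ) ≅ ℂ`, `X(ℂ)` being path connected — the tree's
   PROVED `connectedSpace_complexPoints` and `singularCohomologyZeroEquiv` — on which `h = -d ≠ 0`).
2. The graded Jacobson–Morozov lemma (`Algebra/Lie/LefschetzModule`, PROVED: `HasLefschetzProperty.dual`,
   `isSl2Triple_dual`) gives André's `ᶜΛ` with `(L_η, h, ᶜΛ)` an `sl₂`-triple: `IsDualLefschetz d η ᶜΛ`.
3. `*_L` reverses the `sl₂`-strings (`isStringReversal_totalLefschetzInvolution`: on `H^{d-k}` it is `Lᵏ`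
   — `lefschetzInvolution_apply_of_le` — and on `H^{d+k}` the inverse of `Lᵏ` — `lefschetzInvolution_lefschetzPow`;
   criterion `Algebra.Lie.isStringReversal_of_apply_eq`), so Kleiman's 1.4.4 in its abstract form
   (`Algebra/Lie/LefschetzModuleStringReversal`, PROVED: `HasLefschetzProperty.dual_mem_adjoin` — `ᶜΛ` is the
   explicit non-commutative polynomial `kleimanDual` in `L` and `*_L L *_L`) gives `ᶜΛ ∈ ℂ[L_η, *_L]`.

## Contents

* `ofDegree_lefschetzInvolution_congr` (degree bookkeeping), `totalLefschetzInvolution_apply_of_mem_degreeSpace`,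
  `totalLefschetzInvolution_pow_totalLefschetz_apply` (the two defining clauses of `*_L` on the degree parts
  `M_{-k} = H^{d-k}`), `isStringReversal_totalLefschetzInvolution`;
* `degreeOperator_complexPoints_ne_zero` (`h ≠ 0` for `X` smooth projective, `d ≥ 1`),
  `complexBetti_eq_zero_of_lt` (`Hᵏ = 0`, `k > 2d`), `hasLefschetzProperty_complexPoints`;
* **`Andre1996_dualLefschetz_mem_adjoin_lefschetzInvolution_holds`** — the discharge;
* unconditional corollaries `hasDualLefschetz_of_isSmoothProjective` (hard Lefschetz ⇒ `HasDualLefschetz`) and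
  `IsPolarizationClass.hasDualLefschetz` (the planner's guarded S1, now a theorem), replacing the conditional
  `Andre1996_dualLefschetz_mem_adjoin_lefschetzInvolution.hasDualLefschetz(_of_isPolarizationClass)`;
* (appended) the converse and the `∀`-form: `hasHardLefschetzProperty_of_isDualLefschetz_complexPoints`,
  `hasDualLefschetz_iff_hasHardLefschetzProperty_complexPoints` (Looijenga–Lunts (1.1) for smooth projective `X`),
  `mem_adjoin_lefschetzInvolution_of_isDualLefschetz` (EVERY dual Lefschetz operator lies in `ℂ[L_η, *_L]`).
-/

noncomputable section

open DirectSum Module Function Set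
open Literature.AlgebraicTopology.SingularHomology
open Literature.Geometry.Kaehler
open Literature.Algebra.Lie
open Literature.AlgebraicGeometry.Hyperkaehler

namespace Literature.AlgebraicGeometry.HodgeTheory

variable {X : Motives.SchemeOver ℂ} {η : complexBetti X 2} {d : ℕ}

/-! ### `*_L` reverses the `sl₂`-strings -/

/-- Degree bookkeeping: the value of `*_L` placed in total cohomology does not depend on how the target degree
`b = 2d - a` is written (private plumbing). [folklore] -/
private theorem ofDegree_lefschetzInvolution_congr (hL : HasHardLefschetzProperty η d) {a b b' : ℕ}
    (hab : a + b = 2 * d) (hab' : a + b' = 2 * d) (x : complexBetti X a) :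
    ofDegree ℂ (Motives.ComplexPoints X) b (lefschetzInvolution hL hab x) =
      ofDegree ℂ (Motives.ComplexPoints X) b' (lefschetzInvolution hL hab' x) := by
  obtain rfl : b = b' := by omega
  rfl

/-- **First clause of `*_L` on the degree part `M_{-k} = H^{d-k}`: `*_L = L_ηᵏ`** ("donnée en chaque degré par
l'isomorphisme de Lefschetz"; `lefschetzInvolution_apply_of_le` placed in `H*`). For `k > d` the degree part is
`0`. [cite: Andre1996Motifs, §0.2 (p. 7) and §1.1 (p. 10)] -/
theorem totalLefschetzInvolution_apply_of_mem_degreeSpace (hL : HasHardLefschetzProperty η d) (k : ℕ)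
    {v : totalCohomology ℂ (Motives.ComplexPoints X)}
    (hv : v ∈ degreeSpace (degreeOperator ℂ (Motives.ComplexPoints X) d) (-(k : ℤ))) :
    totalLefschetzInvolution hL v = (totalLefschetz η ^ k) v := by
  rcases le_or_gt k d with hkd | hkd
  · obtain ⟨n, rfl⟩ : ∃ n, d = n + k := ⟨d - k, by omega⟩
    rw [degreeSpace_degreeOperator_eq_range (n + k) n (by push_cast; ring)] at hv
    obtain ⟨x, rfl⟩ := hv
    rw [pow_totalLefschetz_ofDegree, totalLefschetzInvolution_ofDegree hL (show n ≤ 2 * (n + k) by omega),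
      ← lefschetzInvolution_apply_of_le hL (a := n) (j := k) rfl (by omega)]
    exact ofDegree_lefschetzInvolution_congr hL _ _ x
  · rw [degreeSpace_degreeOperator_eq_bot d (by omega), Submodule.mem_bot] at hv
    rw [hv, map_zero, map_zero]

/-- **Second clause of `*_L` on `L_ηᵏ M_{-k} = H^{d+k}`: `*_L ∘ L_ηᵏ = id` on `H^{d-k}`** ("… ou son inverse";
`lefschetzInvolution_lefschetzPow` placed in `H*`). [cite: Andre1996Motifs, §0.2 (p. 7) and §1.1 (p. 10)] -/
theorem totalLefschetzInvolution_pow_totalLefschetz_apply (hL : HasHardLefschetzProperty η d) (k : ℕ)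
    {v : totalCohomology ℂ (Motives.ComplexPoints X)}
    (hv : v ∈ degreeSpace (degreeOperator ℂ (Motives.ComplexPoints X) d) (-(k : ℤ))) :
    totalLefschetzInvolution hL ((totalLefschetz η ^ k) v) = v := by
  rcases le_or_gt k d with hkd | hkd
  · obtain ⟨n, rfl⟩ : ∃ n, d = n + k := ⟨d - k, by omega⟩
    rw [degreeSpace_degreeOperator_eq_range (n + k) n (by push_cast; ring)] at hv
    obtain ⟨x, rfl⟩ := hv
    rw [pow_totalLefschetz_ofDegree,
      totalLefschetzInvolution_ofDegree hL (show n + 2 * k ≤ 2 * (n + k) by omega),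
      ofDegree_lefschetzInvolution_congr hL _ (show n + 2 * k + n = 2 * (n + k) by omega),
      lefschetzInvolution_lefschetzPow hL rfl]
  · rw [degreeSpace_degreeOperator_eq_bot d (by omega), Submodule.mem_bot] at hv
    rw [hv, map_zero, map_zero]

/-- **André's Lefschetz involution `*_L` reverses the `sl₂`-strings of `(H*(X(ℂ); ℂ), h, L_η)`**: on a Lefschetz
component `Lʲ x_i`, `x_i` primitive, `*_L (Lʲ x_i) = L^{d-i-j} x_i` ("`*_L x = Σ L^{d-j+k} x_{j-2k}`").
[cite: Andre1996Motifs, §1.1 (p. 10, the displayed formula for *_L)] -/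
theorem isStringReversal_totalLefschetzInvolution (hL : HasHardLefschetzProperty η d)
    (L : HasLefschetzProperty (degreeOperator ℂ (Motives.ComplexPoints X) d) (totalLefschetz η)) :
    IsStringReversal (degreeOperator ℂ (Motives.ComplexPoints X) d) (totalLefschetz η)
      (totalLefschetzInvolution hL) :=
  isStringReversal_of_apply_eq L (fun k _ hv ↦ totalLefschetzInvolution_apply_of_mem_degreeSpace hL k hv)
    (fun k _ hv ↦ totalLefschetzInvolution_pow_totalLefschetz_apply hL k hv)

/-! ### The Lefschetz module of a smooth projective variety -/

/-- **`Hᵏ(X(ℂ); ℂ) = 0` for `k > 2 dim X`** (the tree's `Motives.ComplexPoints.subsingleton_singularCohomology_of_lt`,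
element form). [cite: HatcherAT2002, §3.3 Thm. 3.26(c)] -/
theorem complexBetti_eq_zero_of_lt (hX : Motives.IsSmoothProjective d X) (k : ℕ) (hk : 2 * d < k)
    (x : complexBetti X k) : x = 0 := by
  haveI := Motives.ComplexPoints.subsingleton_singularCohomology_of_lt hX ℂ hk
  exact Subsingleton.elim x 0

/-- **The degree operator of a smooth projective variety of dimension `d ≥ 1` is non-zero**: `X(ℂ)` is path
connected (connected — `connectedSpace_complexPoints` — and a topological manifold), so `H⁰(X(ℂ); ℂ) ≅ ℂ ≠ 0`
(`singularCohomologyZeroEquiv`), and `h = -d ≠ 0` there. [cite: HatcherAT2002, §3.1 p. 199] [cite: SGA1, Exp. XII Prop. 2.4] -/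
theorem degreeOperator_complexPoints_ne_zero (hX : Motives.IsSmoothProjective d X) (hd : 0 < d) :
    degreeOperator ℂ (Motives.ComplexPoints X) d ≠ 0 := by
  letI := hX.chartedSpace
  haveI := connectedSpace_complexPoints hX
  haveI : LocallyPathConnectedSpace (Motives.ComplexPoints X) :=
    ChartedSpace.locallyPathConnectedSpace (EuclideanSpace ℝ (Fin (2 * d))) (Motives.ComplexPoints X)
  haveI : PathConnectedSpace (Motives.ComplexPoints X) := pathConnectedSpace_iff_connectedSpace.mpr ‹_›
  have h1 : (singularCohomologyZeroEquiv ℂ ℂ (Motives.ComplexPoints X)).symm 1 ≠ 0 :=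
    (singularCohomologyZeroEquiv ℂ ℂ (Motives.ComplexPoints X)).symm.map_ne_zero_iff.2 one_ne_zero
  exact degreeOperator_ne_zero_of_ne_zero (k := 0) (by omega) h1

/-- **`(H*(X(ℂ); ℂ), h, L_η)` is a Lefschetz module** for `X` smooth projective of dimension `d` and `η`
hard-Lefschetz in dimension `d` (`hasLefschetzProperty_totalLefschetz` with the vanishing `Hᵏ = 0`, `k > 2d`).
[cite: LooijengaLunts1997, §1 (1.1) p. 4] [cite: Andre1996Motifs, §1.1 (p. 10)] -/
theorem hasLefschetzProperty_complexPoints (hX : Motives.IsSmoothProjective d X)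
    (hL : HasHardLefschetzProperty η d) :
    HasLefschetzProperty (degreeOperator ℂ (Motives.ComplexPoints X) d) (totalLefschetz η) :=
  hasLefschetzProperty_totalLefschetz η hL (complexBetti_eq_zero_of_lt hX)

/-! ### The discharge -/

/-- **André 1996 §1.1–1.2 with Prop. 1.2 (Kleiman 1968, 1.4.4–1.4.6), PROVED**: for a hard-Lefschetz class `η` on a
smooth projective `X` of dimension `d ≥ 1`, the `sl₂`-partner `ᶜΛ` of `L_η` exists (`IsDualLefschetz d η ᶜΛ`) and
lies in the subalgebra of `End H*(X(ℂ); ℂ)` generated by `L_η` and the Lefschetz involution `*_L`.  The witness is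
`HasLefschetzProperty.dual` (the graded Jacobson–Morozov partner = André's `ᶜΛ` = Kleiman's polynomial
`kleimanDual` in `L_η`, `*_L L_η *_L`).  This discharges the named fact (D-0014 `_holds`).
[cite: Andre1996Motifs, §1.1 pp. 10–11, §1.2 p. 11 first sentence and Prop. 1.2 p. 11]
[cite: Kleiman1968AlgebraicCycles, §1.4, 1.4.4–1.4.6] [cite: LooijengaLunts1997, §1 (1.1) p. 4] -/
theorem Andre1996_dualLefschetz_mem_adjoin_lefschetzInvolution_holds :
    Andre1996_dualLefschetz_mem_adjoin_lefschetzInvolution := by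
  intro d hd X hX η hL
  haveI : Module.Finite ℂ (totalCohomology ℂ (Motives.ComplexPoints X)) := finite_totalCohomology hX
  have L := hasLefschetzProperty_complexPoints hX hL
  have hgr := isZGrading_degreeOperator (K := ℂ) (Y := Motives.ComplexPoints X) d
  exact ⟨L.dual hgr, L.isSl2Triple_dual hgr (degreeOperator_complexPoints_ne_zero hX hd),
    L.dual_mem_adjoin hgr (isStringReversal_totalLefschetzInvolution hL L)⟩

/-! ### Unconditional corollaries -/

/-- **Hard Lefschetz ⇒ a dual Lefschetz operator exists** ("by Jacobson–Morozov", Looijenga–Lunts §1 p. 4), for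
every smooth projective `X` of dimension `d ≥ 1` over `ℂ` and every hard-Lefschetz class `η`: `HasDualLefschetz d η`
— the conditional `Andre1996_dualLefschetz_mem_adjoin_lefschetzInvolution.hasDualLefschetz`, now a theorem.
[cite: Andre1996Motifs, §1.2 p. 11 first sentence] [cite: LooijengaLunts1997, §1 p. 4] -/
theorem hasDualLefschetz_of_isSmoothProjective (hd : 0 < d) (hX : Motives.IsSmoothProjective d X)
    (η : complexBetti X 2) (hL : HasHardLefschetzProperty η d) : HasDualLefschetz d η :=
  Andre1996_dualLefschetz_mem_adjoin_lefschetzInvolution_holds.hasDualLefschetz hd hX η hL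

/-- **A polarisation class of a smooth projective variety of positive dimension has an `sl₂` dual Lefschetz
operator** (the planner's S1 `PolarizationHasDualLefschetz` with its two implicit hypotheses, now a theorem).
[cite: Andre1996Motifs, §1.2 p. 11 first sentence] [cite: LooijengaLunts1997, §1 p. 4] -/
theorem IsPolarizationClass.hasDualLefschetz {n : ℕ} (hn : 0 < n) (hX : Motives.IsSmoothProjective n X)
    (hη : IsPolarizationClass n X η) : HasDualLefschetz n η :=
  Andre1996_dualLefschetz_mem_adjoin_lefschetzInvolution_holds.hasDualLefschetz_of_isPolarizationClass hn hX hη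

/-! ### Every dual Lefschetz operator of a smooth projective variety is André's `ᶜΛ` -/

/-- **An `sl₂`-triple `(L_η, h, Λ)` on `H*(X(ℂ); ℂ)`, `X` smooth projective of dimension `d`, forces the hard
Lefschetz property of `η` in dimension `d`** (Looijenga–Lunts (1.1) "⇐" on the real carriers:
`Hyperkaehler.hasHardLefschetzProperty_of_isDualLefschetz` with `Hyperkaehler.finite_totalCohomology`).
[cite: LooijengaLunts1997, §1 (1.1) p. 4 L1–L5] -/
theorem hasHardLefschetzProperty_of_isDualLefschetz_complexPoints (hX : Motives.IsSmoothProjective d X)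
    {Λ : Module.End ℂ (totalCohomology ℂ (Motives.ComplexPoints X))} (hΛ : IsDualLefschetz d η Λ) :
    HasHardLefschetzProperty η d := by
  haveI : Module.Finite ℂ (totalCohomology ℂ (Motives.ComplexPoints X)) := finite_totalCohomology hX
  exact hasHardLefschetzProperty_of_isDualLefschetz hΛ

/-- **Looijenga–Lunts (1.1) for a smooth projective `X` of dimension `d ≥ 1`: `η ∈ H²(X(ℂ); ℂ)` has a dual
Lefschetz operator iff it has the hard Lefschetz property in dimension `d`.**
[cite: LooijengaLunts1997, §1 (1.1) p. 4 L1–L5] [cite: Andre1996Motifs, §1.2 p. 11 first sentence] -/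
theorem hasDualLefschetz_iff_hasHardLefschetzProperty_complexPoints (hd : 0 < d)
    (hX : Motives.IsSmoothProjective d X) (η : complexBetti X 2) :
    HasDualLefschetz d η ↔ HasHardLefschetzProperty η d := by
  haveI : Module.Finite ℂ (totalCohomology ℂ (Motives.ComplexPoints X)) := finite_totalCohomology hX
  exact hasDualLefschetz_iff_hasHardLefschetzProperty η (complexBetti_eq_zero_of_lt hX)
    (degreeOperator_complexPoints_ne_zero hX hd)

/-- **André's Prop. 1.2 for EVERY dual Lefschetz operator** (not only the constructed one): if `(L_η, h, Λ)` is an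
`sl₂`-triple on `H*(X(ℂ); ℂ)`, `X` smooth projective of dimension `d`, then `Λ` is André's `ᶜΛ` (uniqueness of the
`sl₂`-partner, `Algebra.Lie.dualPartner_unique`) and hence lies in `ℂ[L_η, *_L]` — for any hard-Lefschetz witness
`hL` used to form `*_L`. [cite: Andre1996Motifs, §1.2 p. 11 and Prop. 1.2] [cite: LooijengaLunts1997, §1 (1.1) p. 4 L4 ("This f is then unique")] -/
theorem mem_adjoin_lefschetzInvolution_of_isDualLefschetz (hX : Motives.IsSmoothProjective d X)
    (hL : HasHardLefschetzProperty η d) {Λ : Module.End ℂ (totalCohomology ℂ (Motives.ComplexPoints X))}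
    (hΛ : IsDualLefschetz d η Λ) :
    Λ ∈ Algebra.adjoin ℂ
      ({totalLefschetz η, totalLefschetzInvolution hL} :
        Set (Module.End ℂ (totalCohomology ℂ (Motives.ComplexPoints X)))) := by
  haveI : Module.Finite ℂ (totalCohomology ℂ (Motives.ComplexPoints X)) := finite_totalCohomology hX
  have L := hasLefschetzProperty_complexPoints hX hL
  have hgr := isZGrading_degreeOperator (K := ℂ) (Y := Motives.ComplexPoints X) d
  rw [L.eq_dual_of_isSl2Triple hgr hΛ]
  exact L.dual_mem_adjoin hgr (isStringReversal_totalLefschetzInvolution hL L)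

end Literature.AlgebraicGeometry.HodgeTheory

end
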